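import Literature.NumberTheory.LFunctions.SmoothDyadicPartition
import Literature.NumberTheory.LFunctions.BondarenkoHeap2026OffDiagReductionProofs
import Literature.NumberTheory.LFunctions.BondarenkoHeap2026Section6Weights
import HarnessLib

/-!
# Bondarenko–Heap 2026, §6.2 (towards `offDiag_reduction'`), layer L3a: the three-variable smooth
# dyadic partition of `𝒪𝒟` into boxes with `corrSumE`-shaped ranges

Topic `Literature/NumberTheory/LFunctions`, namespace
`Literature.NumberTheory.LFunctions.BondarenkoHeap2026`. LABEL (cell `rh-crit`, corpus C5 `ah`):
**NOT RH-BEARING** — finite re-indexing of a triple sum inside §6.2 of an unrefereed preprint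
(A. Bondarenko, W. Heap, arXiv:2608.07399v1); nothing here bears on the truth of RH.

The printed step ([BondarenkoHeap2026, §6.2, TeX l.742–770], verbatim): "The exact off-diagonals
are given by `𝒪𝒟 = Σ_{m,n ⩽ L, r ∈ ℤ∖{0}, k ≪ L : n−km=r} Λ(k)g_h(k)χ(m)χ(n)G(m)G(n)/√(kmn) ·
Ŵ_T(log(n/km)/2π)`. We treat the case of `r>0`, the argument for `r<0` being similar. We first
apply a dyadic partition of unity of the form `Σ_X ω(x/X)² = 1` in each variable `k,m,r` where `ω`
is a smooth function supported on `[1,2]` and where `X` varies over a dyadic sequence, `2^j` say,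
with upper bound `≪ L`." … "Note that from the support of `Ŵ` we have the restrictions
`R ≪ KM/T, KM ≪ L`; the second following from the first and the fact that `KM+R ≪ L`."
OUR READING (glosses, not quotations): both signs of `r` are carried at once; the scales are the
ratio-`√2` sequence `X = √2^{i−1}` with `ω = bump` of `SmoothDyadicPartition`
(`Σ_i bump(x/√2^{i−1})² = 1` on `[1, √2^J]`; windows `[X, 2X]`, floors `X ≥ 1/√2` — correction
G-ah-9b: with windows `[X,2X]` and ratio `2` the integer `X` itself is never covered), and the
implied constants of `R ≪ KM/T`, `KM ≪ L` are made explicit (`32πσ`, `3`). Starting from the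
sibling's finite form over shifts (`offDiagOD_eq_sum_shifts`, `…OffDiagReductionProofs`), this file

* frees the ranges: `𝒪𝒟 = Σ_{k ≤ K₀} Σ_{m ≤ N} Σ_{r ≤ R_top} Φ(k,m,r)` for every `R_top` dominating
  the shift cut-offs, where `Φ(k,m,r) = jTerm(k,m,km+r) + 1_{r<km}·jTerm(k,m,km−r)` (`odPhi`)
  carries BOTH signs of the shift and no longer any range bookkeeping — the summand vanishes by
  itself outside the printed ranges (`Ŵ`-support: `jTerm_shift_eq_zero`,
  `jTerm_eq_zero_of_neg_shift`; `k`-cutoff: `jTerm_eq_zero_of_lt`; `r(n) = 0` for `n > L`: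
  `coeff_eq_zero_of_lengthL_lt`) —
  `offDiagOD_eq_sum_uniform`;
* inserts the smooth partition of unity `Σ_i bump(x/√2^{i−1})² = 1` of `SmoothDyadicPartition`
  (ratio-`√2` scales `X_i = √2^{i−1} ≥ 1/√2`, windows `[X_i, 2X_i]` — G-ah-9b) in each of `k, m, r`
  (`sum_sum_sum_eq_sum_boxes`, pure algebra), and
* shrinks, box by box, the index sets to EXACTLY the ranges of `corrSumE`, `1 ≤ k ≤ ⌊2K⌋`,
  `1 ≤ m ≤ ⌊2M⌋`, `1 ≤ r ≤ ⌊2R⌋` (`offDiagOD_eq_sum_boxes`, the main result: `𝒪𝒟 = Σ_{boxes}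
  (odBoxPos + odBoxNeg)`);
* records that a box with a nonzero contribution has primed-admissible scales
  (`isAdmissibleScale'_of_odBox_ne_zero`: `R ≤ 32πσ·KM/T`, `KM ≤ 3L`, floors `1/2`) and `K ≥ √2`
  (`sqrt_two_le_of_odBox_ne_zero`: `Λ(1) = 0` and the window is open), isolates the smooth coupled
  factor of `jTerm` for the Mellin separation (`jTerm_eq_vonMangoldt_mul`), counts the boxes
  (`exists_box_indices`, `J ≤ 2 log Y/log 2 + 1` per index), and supplies the all-order derivative
  bounds of the complex profile `y ↦ (ω(y)² : ℂ)` with ONE family, `A 0 ≤ 1`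
  (`exists_family_iteratedDeriv_bump_sq_ofReal`), for the separated `r`-weight `ω(x/R)²(x/R)^{−z}`.

The Mellin separation of each box into an integral of `corrSumE`'s (layer L3b) and the assembly
`⇒ offDiag_reduction'` are the sibling `…OffDiagReductionAssembly` (t4).

Correction of record (referee note n4, quotation hygiene): the docstrings of the sibling
`…Section6WeightsProofs` (v1/v2) attach the phrase «pieces with `K`, `M` or `R < 1` are finitely
many single terms» to TeX l.840 inside quotation marks. That phrase is OUR GLOSS, not the print's:
the print (l.834–840) is silent on sub-unit scales — which is precisely the gap (E-ah-3/G-ah-9b)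
that the primed interface `IsAdmissibleScale'` closes. The mathematics there is unaffected.

## References

* [BondarenkoHeap2026] arXiv:2608.07399v1, §6.2, TeX l.742–770 (partition, `R ≪ KM/T`, `KM ≪ L`),
  l.834–840 (weights and scales); §2.3 p. 7–8 (`r(n) = χ(n)G(n)`, `G(n) = G₀(log n/log L) f₀(n/L)`).
-/

noncomputable section

open scoped ArithmeticFunction.vonMangoldt ContDiff
open Real Finset
open Literature.NumberTheory.LFunctions.SmoothDyadicPartition

namespace Literature.NumberTheory.LFunctions.BondarenkoHeap2026

/-! ### The summand with both shift signs, and the box sums -/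

/-- `Φ(k,m,r) = jTerm(k,m,km+r) + 1_{r<km}·jTerm(k,m,km−r)`: the off-diagonal summand of `𝒪𝒟` at
shift `±r` — the print treats "the case of `r>0`, the argument for `r<0` being similar" (l.749);
here both signs are carried (our bookkeeping). [cite: BondarenkoHeap2026, §6.2, TeX l.742–749] -/
def odPhi (c : ℝ) (w : Bump) (B : ℕ) (ρ : Resonator) {q : ℕ} (χ : DirichletCharacter ℂ q)
    (k m r : ℕ) : ℝ :=
  jTerm c w B (ρ.coeff χ) (ρ.T q) k m (k * m + r) +
    (if r < k * m then jTerm c w B (ρ.coeff χ) (ρ.T q) k m (k * m - r) else 0)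

/-- The box sum at scales `(K, M, R)`, positive shifts: `Σ_{k ≤ 2K} Σ_{m ≤ 2M} Σ_{r ≤ 2R}
ω(k/K)² ω(m/M)² ω(r/R)² · jTerm(k,m,km+r)` with `ω = bump` (windows `[X,2X]`), over exactly the
index ranges of `corrSumE`. [cite: BondarenkoHeap2026, §6.2, TeX l.751–766] -/
def odBoxPos (c : ℝ) (w : Bump) (B : ℕ) (ρ : Resonator) {q : ℕ} (χ : DirichletCharacter ℂ q)
    (K M R : ℝ) : ℝ :=
  ∑ k ∈ Icc 1 ⌊2 * K⌋₊, ∑ m ∈ Icc 1 ⌊2 * M⌋₊, ∑ r ∈ Icc 1 ⌊2 * R⌋₊,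
    bump ((k : ℝ) / K) ^ 2 * bump ((m : ℝ) / M) ^ 2 * bump ((r : ℝ) / R) ^ 2 *
      jTerm c w B (ρ.coeff χ) (ρ.T q) k m (k * m + r)

/-- The box sum at scales `(K, M, R)`, negative shifts (`n = km − r ≥ 1`).
[cite: BondarenkoHeap2026, §6.2, TeX l.749–766] -/
def odBoxNeg (c : ℝ) (w : Bump) (B : ℕ) (ρ : Resonator) {q : ℕ} (χ : DirichletCharacter ℂ q)
    (K M R : ℝ) : ℝ :=
  ∑ k ∈ Icc 1 ⌊2 * K⌋₊, ∑ m ∈ Icc 1 ⌊2 * M⌋₊, ∑ r ∈ Icc 1 ⌊2 * R⌋₊,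
    bump ((k : ℝ) / K) ^ 2 * bump ((m : ℝ) / M) ^ 2 * bump ((r : ℝ) / R) ^ 2 *
      (if r < k * m then jTerm c w B (ρ.coeff χ) (ρ.T q) k m (k * m - r) else 0)

/-- `odBoxPos + odBoxNeg` is the box sum of `Φ`. [cite: BondarenkoHeap2026, §6.2, TeX l.749] -/
theorem odBoxPos_add_odBoxNeg (c : ℝ) (w : Bump) (B : ℕ) (ρ : Resonator) {q : ℕ}
    (χ : DirichletCharacter ℂ q) (K M R : ℝ) :
    odBoxPos c w B ρ χ K M R + odBoxNeg c w B ρ χ K M R =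
      ∑ k ∈ Icc 1 ⌊2 * K⌋₊, ∑ m ∈ Icc 1 ⌊2 * M⌋₊, ∑ r ∈ Icc 1 ⌊2 * R⌋₊,
        bump ((k : ℝ) / K) ^ 2 * bump ((m : ℝ) / M) ^ 2 * bump ((r : ℝ) / R) ^ 2 *
          odPhi c w B ρ χ k m r := by
  simp only [odBoxPos, odBoxNeg, odPhi, mul_add, Finset.sum_add_distrib]

/-! ### The smooth coupled factor of `jTerm` -/

/-- `jTerm(k,m,n) = Λ(k) · χ(m) · χ(n) · [g_h(k) G(m) G(n) (kmn)^{−1/2} Ŵ_T(log(km/n)/2π)]` with the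
resonator coefficients `r(n) = χ(n)G(n)` unfolded: the bracket is the smooth function of
`(k, m, n)` that §6.2 separates by Mellin inversion.
[cite: BondarenkoHeap2026, §6.2, TeX l.771–833] -/
theorem jTerm_eq_vonMangoldt_mul (c : ℝ) (w : Bump) (B : ℕ) (ρ : Resonator) {q : ℕ}
    (χ : DirichletCharacter ℂ q) (k m n : ℕ) :
    jTerm c w B (ρ.coeff χ) (ρ.T q) k m n =
      Λ k * (χ (m : ZMod q)).re * (χ (n : ZMod q)).re *
        (gWeight (gapWidth c (ρ.T q)) k * ρ.G q m * ρ.G q n / Real.sqrt ((k : ℝ) * m * n) *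
          weightHat w B (ρ.T q) (Real.log ((k : ℝ) * m / n) / (2 * π))) := by
  simp only [jTerm, Resonator.coeff]
  ring

/-! ### Vanishing of the summand outside the printed ranges -/

/-- `r(n) = χ(n) G₀(log n/log L) f₀(n/L) = 0` for `n > L` (`f₀ = 0` on `[1, ∞)`).
[cite: BondarenkoHeap2026, §2.3 p. 8 (G(n), f)] -/
theorem coeff_eq_zero_of_lengthL_lt (ρ : Resonator) {q : ℕ} (hq : 1 ≤ q)
    (χ : DirichletCharacter ℂ q) {n : ℕ} (hn : lengthL q < n) : ρ.coeff χ n = 0 := by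
  have hL0 : 0 < lengthL q := by
    unfold lengthL
    exact Real.rpow_pos_of_pos (by exact_mod_cast hq) _
  have h1 : (1 : ℝ) ≤ n / lengthL q := by
    rw [le_div_iff₀ hL0]; linarith
  simp [Resonator.coeff, Resonator.G, ρ.f₀_eq_zero _ h1]

/-- `T = q^{7/3+δ} > 0`. [cite: BondarenkoHeap2026, §2.3 (5) p. 8] -/
theorem resonatorT_pos (ρ : Resonator) {q : ℕ} (hq : 1 ≤ q) : 0 < ρ.T q := by
  unfold Resonator.T
  exact Real.rpow_pos_of_pos (by exact_mod_cast hq) _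

/-- **The `k`-cutoff without the constraint `n ≤ L`**: for `k > L e^{4πσ/T}`, `m ≥ 1`, `n ≥ 1`,
`jTerm(k,m,n) = 0` — by `jTerm_eq_zero_of_lt` when `n ≤ L`, and because `r(n) = 0` when `n > L`.
[cite: BondarenkoHeap2026, §2.2 p. 7, §6.2 l.766] -/
theorem jTerm_eq_zero_of_cutoff_lt (c : ℝ) (w : Bump) (B : ℕ) (ρ : Resonator) {q : ℕ} (hq : 1 ≤ q)
    (χ : DirichletCharacter ℂ q) {k m n : ℕ} (hm : 1 ≤ m) (hn : 1 ≤ n)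
    (hk : lengthL q * Real.exp (4 * π * w.σ / ρ.T q) < k) :
    jTerm c w B (ρ.coeff χ) (ρ.T q) k m n = 0 := by
  by_cases hnL : (n : ℝ) ≤ lengthL q
  · exact jTerm_eq_zero_of_lt c w B (ρ.coeff χ) (resonatorT_pos ρ hq) hm hn hnL hk
  · have h := coeff_eq_zero_of_lengthL_lt ρ hq χ (lt_of_not_ge hnL)
    simp [jTerm, h]

/-- `Φ(k,m,r) = 0` for `k > L e^{4πσ/T}` (`m ≥ 1`). [cite: BondarenkoHeap2026, §6.2, TeX l.766] -/
theorem odPhi_eq_zero_of_cutoff_lt (c : ℝ) (w : Bump) (B : ℕ) (ρ : Resonator) {q : ℕ} (hq : 1 ≤ q)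
    (χ : DirichletCharacter ℂ q) {k m : ℕ} (hm : 1 ≤ m)
    (hk : lengthL q * Real.exp (4 * π * w.σ / ρ.T q) < k) (r : ℕ) :
    odPhi c w B ρ χ k m r = 0 := by
  have hk0 : (0 : ℝ) < k :=
    lt_of_le_of_lt (mul_nonneg (by unfold lengthL; positivity) (Real.exp_pos _).le) hk
  have hk1 : 1 ≤ k := by exact_mod_cast hk0
  have hkm : 1 ≤ k * m := Nat.one_le_iff_ne_zero.mpr (Nat.mul_ne_zero (by omega) (by omega))
  unfold odPhi
  rw [jTerm_eq_zero_of_cutoff_lt c w B ρ hq χ hm (n := k * m + r) (by omega) hk, zero_add]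
  split_ifs with hr
  · exact jTerm_eq_zero_of_cutoff_lt c w B ρ hq χ hm (n := k * m - r) (by omega) hk
  · rfl

/-- `Φ(k,m,r) = 0` for `m > L` (`r(m) = 0`). [cite: BondarenkoHeap2026, §2.3 p. 8, §6.2 l.742] -/
theorem odPhi_eq_zero_of_lengthL_lt (c : ℝ) (w : Bump) (B : ℕ) (ρ : Resonator) {q : ℕ} (hq : 1 ≤ q)
    (χ : DirichletCharacter ℂ q) {m : ℕ} (hm : lengthL q < m) (k r : ℕ) :
    odPhi c w B ρ χ k m r = 0 := by
  have h := coeff_eq_zero_of_lengthL_lt ρ hq χ hm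
  simp [odPhi, jTerm, h]

/-- `Φ(k,m,r) = 0` for `8πσ·km < rT` (both signs: `jTerm_shift_eq_zero`,
`jTerm_eq_zero_of_neg_shift` with `n = km − r ≤ km`).
[cite: BondarenkoHeap2026, §6.2, TeX l.766–770] -/
theorem odPhi_eq_zero_of_shift_lt (c : ℝ) (w : Bump) (B : ℕ) (ρ : Resonator) {q : ℕ}
    (hT : 4 * π * w.σ / Real.log 2 < ρ.T q) (χ : DirichletCharacter ℂ q) {k m r : ℕ}
    (hkm : 1 ≤ k * m) (h : 8 * π * w.σ * ((k * m : ℕ) : ℝ) < r * ρ.T q) :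
    odPhi c w B ρ χ k m r = 0 := by
  have hσ : 0 < w.σ := w.σ_pos
  unfold odPhi
  rw [jTerm_shift_eq_zero c w B (ρ.coeff χ) hT hkm h, zero_add]
  split_ifs with hr
  · refine jTerm_eq_zero_of_neg_shift c w B (ρ.coeff χ) hT (n := k * m - r) (r := r) (by omega)
      (by omega) ?_
    have h2 : ((k * m - r : ℕ) : ℝ) ≤ ((k * m : ℕ) : ℝ) := by exact_mod_cast Nat.sub_le _ _
    have h3 := mul_le_mul_of_nonneg_left h2 (by positivity : (0 : ℝ) ≤ 8 * π * w.σ)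
    linarith
  · rfl

/-! ### Freeing the ranges: uniform index sets -/

/-- For fixed `k, m ≥ 1`: the two shift sums of `offDiagOD_eq_sum_shifts` (ranges cut at
`⌊8πσkm/T⌋` and guarded by `n ≤ ⌊L⌋`) equal `Σ_{1 ≤ r ≤ R_top} Φ(k,m,r)` for any `R_top` beyond the
cut — the guards and cuts only remove vanishing terms.
[cite: BondarenkoHeap2026, §6.2, TeX l.742–770] -/
theorem shiftSums_eq_sum_odPhi (c : ℝ) (w : Bump) (B : ℕ) (ρ : Resonator) {q : ℕ} (hq : 1 ≤ q)
    (hT : 4 * π * w.σ / Real.log 2 < ρ.T q) (χ : DirichletCharacter ℂ q) {k m : ℕ} (hk : 1 ≤ k)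
    (hm : 1 ≤ m) {Rtop : ℕ} (hR : ⌊8 * π * w.σ * ((k * m : ℕ) : ℝ) / ρ.T q⌋₊ ≤ Rtop) :
    ((∑ r ∈ Icc 1 ⌊8 * π * w.σ * ((k * m : ℕ) : ℝ) / ρ.T q⌋₊,
        if k * m + r ≤ ⌊lengthL q⌋₊ then jTerm c w B (ρ.coeff χ) (ρ.T q) k m (k * m + r) else 0) +
      ∑ r ∈ Icc 1 (min (k * m - 1) ⌊8 * π * w.σ * ((k * m : ℕ) : ℝ) / ρ.T q⌋₊),
        if k * m - r ≤ ⌊lengthL q⌋₊ then jTerm c w B (ρ.coeff χ) (ρ.T q) k m (k * m - r) else 0) =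
    ∑ r ∈ Icc 1 Rtop, odPhi c w B ρ χ k m r := by
  set Rf : ℕ := ⌊8 * π * w.σ * ((k * m : ℕ) : ℝ) / ρ.T q⌋₊ with hRf
  have hT0 : 0 < ρ.T q := resonatorT_pos ρ hq
  have hσ : 0 < w.σ := w.σ_pos
  have hkm : 1 ≤ k * m := Nat.one_le_iff_ne_zero.mpr (Nat.mul_ne_zero (by omega) (by omega))
  -- a shift beyond the cut kills the term
  have hbig : ∀ r : ℕ, Rf < r → 8 * π * w.σ * ((k * m : ℕ) : ℝ) < r * ρ.T q := by
    intro r hr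
    have h1 : 8 * π * w.σ * ((k * m : ℕ) : ℝ) / ρ.T q < r := Nat.lt_of_floor_lt hr
    rwa [div_lt_iff₀ hT0] at h1
  -- a value `n > ⌊L⌋` kills the term
  have hguard : ∀ n : ℕ, ¬ n ≤ ⌊lengthL q⌋₊ → jTerm c w B (ρ.coeff χ) (ρ.T q) k m n = 0 := by
    intro n hn
    have h1 : lengthL q < n := Nat.lt_of_floor_lt (lt_of_not_ge hn)
    have h := coeff_eq_zero_of_lengthL_lt ρ hq χ h1
    simp [jTerm, h]
  simp only [odPhi, Finset.sum_add_distrib]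
  congr 1
  · -- positive shifts
    have h1 : ∑ r ∈ Icc 1 Rf, (if k * m + r ≤ ⌊lengthL q⌋₊ then
        jTerm c w B (ρ.coeff χ) (ρ.T q) k m (k * m + r) else 0) =
        ∑ r ∈ Icc 1 Rf, jTerm c w B (ρ.coeff χ) (ρ.T q) k m (k * m + r) := by
      refine Finset.sum_congr rfl fun r _ => ?_
      split_ifs with hle
      · rfl
      · exact (hguard _ hle).symm
    rw [h1]
    apply Finset.sum_subset
    · exact Finset.Icc_subset_Icc_right hR
    · intro r hr hr'
      simp only [Finset.mem_Icc, not_and, not_le] at hr hr'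
      exact jTerm_shift_eq_zero c w B (ρ.coeff χ) hT hkm (hbig r (hr' hr.1))
  · -- negative shifts
    have h1 : ∑ r ∈ Icc 1 (min (k * m - 1) Rf), (if k * m - r ≤ ⌊lengthL q⌋₊ then
        jTerm c w B (ρ.coeff χ) (ρ.T q) k m (k * m - r) else 0) =
        ∑ r ∈ Icc 1 (min (k * m - 1) Rf),
          (if r < k * m then jTerm c w B (ρ.coeff χ) (ρ.T q) k m (k * m - r) else 0) := by
      refine Finset.sum_congr rfl fun r hr => ?_
      simp only [Finset.mem_Icc, le_min_iff] at hr
      rw [if_pos (by omega : r < k * m)]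
      split_ifs with hle
      · rfl
      · exact (hguard _ hle).symm
    rw [h1]
    apply Finset.sum_subset
    · exact Finset.Icc_subset_Icc_right ((min_le_right _ _).trans hR)
    · intro r hr hr'
      simp only [Finset.mem_Icc, le_min_iff, not_and, not_le] at hr hr'
      split_ifs with hlt
      · have hRr : Rf < r := by
          by_contra hcon
          push Not at hcon
          have := hr' hr.1
          omega
        refine jTerm_eq_zero_of_neg_shift c w B (ρ.coeff χ) hT (n := k * m - r) (r := r) (by omega)
          (by omega) ?_
        have h2 : ((k * m - r : ℕ) : ℝ) ≤ ((k * m : ℕ) : ℝ) := by exact_mod_cast Nat.sub_le _ _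
        have h3 := mul_le_mul_of_nonneg_left h2 (by positivity : (0 : ℝ) ≤ 8 * π * w.σ)
        linarith [hbig r hRr]
      · rfl

/-- **`𝒪𝒟` over uniform ranges**: with `K₀ = ⌈L e^{4πσ/T}⌉`, `N = ⌊L⌋` and any `R_top` with
`⌊8πσkm/T⌋ ≤ R_top` on the box, `𝒪𝒟 = Σ_{k ≤ K₀} Σ_{m ≤ N} Σ_{r ≤ R_top} Φ(k,m,r)`
(`T > 4πσ/log 2`).
[cite: BondarenkoHeap2026, §6.2, TeX l.742–770] -/
theorem offDiagOD_eq_sum_uniform (c : ℝ) (w : Bump) (B : ℕ) (ρ : Resonator) {q : ℕ} (hq : 1 ≤ q)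
    (hT : 4 * π * w.σ / Real.log 2 < ρ.T q) (χ : DirichletCharacter ℂ q) {Rtop : ℕ}
    (hR : ∀ k ∈ Icc 1 ⌈lengthL q * Real.exp (4 * π * w.σ / ρ.T q)⌉₊, ∀ m ∈ Icc 1 ⌊lengthL q⌋₊,
      ⌊8 * π * w.σ * ((k * m : ℕ) : ℝ) / ρ.T q⌋₊ ≤ Rtop) :
    offDiagOD c w B ρ χ = ∑ k ∈ Icc 1 ⌈lengthL q * Real.exp (4 * π * w.σ / ρ.T q)⌉₊,
      ∑ m ∈ Icc 1 ⌊lengthL q⌋₊, ∑ r ∈ Icc 1 Rtop, odPhi c w B ρ χ k m r := by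
  rw [offDiagOD_eq_sum_shifts c w B ρ hq hT χ, Finset.sum_comm]
  refine Finset.sum_congr rfl fun k hk => Finset.sum_congr rfl fun m hm => ?_
  exact shiftSums_eq_sum_odPhi c w B ρ hq hT χ (Finset.mem_Icc.mp hk).1 (Finset.mem_Icc.mp hm).1
    (hR k hk m hm)

/-! ### Pure algebra: two index sets with the same nonzero terms; the triple partition -/

/-- Two finite index sets carrying the same nonzero terms give the same sum.
[cite: BondarenkoHeap2026, §6.2, TeX l.751] -/
theorem sum_eq_sum_of_eq_zero_off {s t : Finset ℕ} {f : ℕ → ℝ}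
    (hs : ∀ n ∈ s, n ∉ t → f n = 0) (ht : ∀ n ∈ t, n ∉ s → f n = 0) :
    ∑ n ∈ s, f n = ∑ n ∈ t, f n := by
  classical
  have h1 : ∑ n ∈ s, f n = ∑ n ∈ s ∪ t, f n := by
    refine Finset.sum_subset Finset.subset_union_left fun n hn hns => ?_
    rcases Finset.mem_union.mp hn with h | h
    · exact absurd h hns
    · exact ht n h hns
  have h2 : ∑ n ∈ t, f n = ∑ n ∈ s ∪ t, f n := by
    refine Finset.sum_subset Finset.subset_union_right fun n hn hnt => ?_
    rcases Finset.mem_union.mp hn with h | h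
    · exact hs n h hnt
    · exact absurd h hnt
  rw [h1, h2]

/-- **The triple smooth dyadic partition** (pure algebra): for index sets inside `[1, √2^{J₁}]`,
`[1, √2^{J₂}]`, `[1, √2^{J₃}]`,
`Σ_k Σ_m Σ_r Φ = Σ_{i ≤ J₁} Σ_{j ≤ J₂} Σ_{l ≤ J₃} Σ_k Σ_m Σ_r ω(k/√2^{i−1})² ω(m/√2^{j−1})²
ω(r/√2^{l−1})² Φ`
("We first apply a dyadic partition of unity of the form `Σ_X ω(x/X)² = 1` in each variable
`k,m,r`", TeX l.751; ratio `√2` instead of the print's `2^j` — ours, G-ah-9b).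
[cite: BondarenkoHeap2026, §6.2, TeX l.751] -/
theorem sum_sum_sum_eq_sum_boxes (sK sM sR : Finset ℕ) (Φ : ℕ → ℕ → ℕ → ℝ) {J₁ J₂ J₃ : ℕ}
    (hK : ∀ k ∈ sK, (1 : ℝ) ≤ k ∧ (k : ℝ) ≤ Real.sqrt 2 ^ J₁)
    (hM : ∀ m ∈ sM, (1 : ℝ) ≤ m ∧ (m : ℝ) ≤ Real.sqrt 2 ^ J₂)
    (hR : ∀ r ∈ sR, (1 : ℝ) ≤ r ∧ (r : ℝ) ≤ Real.sqrt 2 ^ J₃) :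
    ∑ k ∈ sK, ∑ m ∈ sM, ∑ r ∈ sR, Φ k m r =
      ∑ i ∈ Finset.range (J₁ + 1), ∑ j ∈ Finset.range (J₂ + 1), ∑ l ∈ Finset.range (J₃ + 1),
        ∑ k ∈ sK, ∑ m ∈ sM, ∑ r ∈ sR,
          bump ((k : ℝ) / Real.sqrt 2 ^ ((i : ℤ) - 1)) ^ 2 *
            bump ((m : ℝ) / Real.sqrt 2 ^ ((j : ℤ) - 1)) ^ 2 *
              bump ((r : ℝ) / Real.sqrt 2 ^ ((l : ℤ) - 1)) ^ 2 * Φ k m r := by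
  calc ∑ k ∈ sK, ∑ m ∈ sM, ∑ r ∈ sR, Φ k m r
      = ∑ k ∈ sK, ∑ m ∈ sM, ∑ l ∈ Finset.range (J₃ + 1), ∑ r ∈ sR,
          bump ((r : ℝ) / Real.sqrt 2 ^ ((l : ℤ) - 1)) ^ 2 * Φ k m r := by
        refine Finset.sum_congr rfl fun k _ => Finset.sum_congr rfl fun m _ => ?_
        exact sum_eq_sum_range_bump_sq_mul_real sR (Φ k m) hR
    _ = ∑ k ∈ sK, ∑ j ∈ Finset.range (J₂ + 1), ∑ m ∈ sM,
          bump ((m : ℝ) / Real.sqrt 2 ^ ((j : ℤ) - 1)) ^ 2 *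
            ∑ l ∈ Finset.range (J₃ + 1), ∑ r ∈ sR,
              bump ((r : ℝ) / Real.sqrt 2 ^ ((l : ℤ) - 1)) ^ 2 * Φ k m r := by
        refine Finset.sum_congr rfl fun k _ => ?_
        exact sum_eq_sum_range_bump_sq_mul_real sM (fun m => ∑ l ∈ Finset.range (J₃ + 1),
          ∑ r ∈ sR, bump ((r : ℝ) / Real.sqrt 2 ^ ((l : ℤ) - 1)) ^ 2 * Φ k m r) hM
    _ = ∑ i ∈ Finset.range (J₁ + 1), ∑ k ∈ sK,
          bump ((k : ℝ) / Real.sqrt 2 ^ ((i : ℤ) - 1)) ^ 2 *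
            ∑ j ∈ Finset.range (J₂ + 1), ∑ m ∈ sM,
              bump ((m : ℝ) / Real.sqrt 2 ^ ((j : ℤ) - 1)) ^ 2 *
                ∑ l ∈ Finset.range (J₃ + 1), ∑ r ∈ sR,
                  bump ((r : ℝ) / Real.sqrt 2 ^ ((l : ℤ) - 1)) ^ 2 * Φ k m r :=
        sum_eq_sum_range_bump_sq_mul_real sK (fun k => ∑ j ∈ Finset.range (J₂ + 1), ∑ m ∈ sM,
          bump ((m : ℝ) / Real.sqrt 2 ^ ((j : ℤ) - 1)) ^ 2 * ∑ l ∈ Finset.range (J₃ + 1),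
            ∑ r ∈ sR, bump ((r : ℝ) / Real.sqrt 2 ^ ((l : ℤ) - 1)) ^ 2 * Φ k m r) hK
    _ = _ := by
        refine Finset.sum_congr rfl fun i _ => ?_
        simp_rw [Finset.mul_sum]
        rw [Finset.sum_comm]
        refine Finset.sum_congr rfl fun j _ => ?_
        calc ∑ k ∈ sK, ∑ m ∈ sM, ∑ l ∈ Finset.range (J₃ + 1), ∑ r ∈ sR,
              bump ((k : ℝ) / Real.sqrt 2 ^ ((i : ℤ) - 1)) ^ 2 *
                (bump ((m : ℝ) / Real.sqrt 2 ^ ((j : ℤ) - 1)) ^ 2 *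
                  (bump ((r : ℝ) / Real.sqrt 2 ^ ((l : ℤ) - 1)) ^ 2 * Φ k m r))
            = ∑ k ∈ sK, ∑ l ∈ Finset.range (J₃ + 1), ∑ m ∈ sM, ∑ r ∈ sR,
              bump ((k : ℝ) / Real.sqrt 2 ^ ((i : ℤ) - 1)) ^ 2 *
                (bump ((m : ℝ) / Real.sqrt 2 ^ ((j : ℤ) - 1)) ^ 2 *
                  (bump ((r : ℝ) / Real.sqrt 2 ^ ((l : ℤ) - 1)) ^ 2 * Φ k m r)) :=
              Finset.sum_congr rfl fun k _ => Finset.sum_comm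
          _ = ∑ l ∈ Finset.range (J₃ + 1), ∑ k ∈ sK, ∑ m ∈ sM, ∑ r ∈ sR,
              bump ((k : ℝ) / Real.sqrt 2 ^ ((i : ℤ) - 1)) ^ 2 *
                (bump ((m : ℝ) / Real.sqrt 2 ^ ((j : ℤ) - 1)) ^ 2 *
                  (bump ((r : ℝ) / Real.sqrt 2 ^ ((l : ℤ) - 1)) ^ 2 * Φ k m r)) := Finset.sum_comm
          _ = _ := by
              refine Finset.sum_congr rfl fun l _ => Finset.sum_congr rfl fun k _ =>
                Finset.sum_congr rfl fun m _ => Finset.sum_congr rfl fun r _ => ?_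
              ring

/-! ### The main re-indexing: `𝒪𝒟` as a sum of boxes with `corrSumE`-shaped ranges -/

/-- Outside the window the partition weight vanishes: `bump(n/X) = 0` for `n > ⌊2X⌋` (`X > 0`).
[cite: BondarenkoHeap2026, §6.2, TeX l.834] -/
theorem bump_div_eq_zero_of_floor_lt {X : ℝ} (hX : 0 < X) {n : ℕ} (hn : ⌊2 * X⌋₊ < n) :
    bump ((n : ℝ) / X) = 0 := by
  have h1 : 2 * X < n := Nat.lt_of_floor_lt hn
  exact bump_eq_zero_of_two_le (by rw [le_div_iff₀ hX]; linarith)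

/-- **`𝒪𝒟 = Σ_{boxes} (odBoxPos + odBoxNeg)`** — the dyadic partition of unity in `k, m, r` at
ratio-`√2` scales `K = √2^{i−1}`, `M = √2^{j−1}`, `R = √2^{l−1}`, `i ≤ J₁`, `j ≤ J₂`, `l ≤ J₃`,
whenever `√2^{J₁} ≥ K₀ = ⌈L e^{4πσ/T}⌉`, `√2^{J₂} ≥ N = ⌊L⌋` and `√2^{J₃} ≥ 8πσ √2^{J₁}√2^{J₂}/T`
(`T > 4πσ/log 2`); inside each box the index ranges are exactly those of `corrSumE`
(`1 ≤ k ≤ ⌊2K⌋`, …), the partition weights `bump(·/X)²` vanishing off `[X, 2X]` and the summand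
vanishing off the printed ranges. [cite: BondarenkoHeap2026, §6.2, TeX l.742–770] -/
theorem offDiagOD_eq_sum_boxes (c : ℝ) (w : Bump) (B : ℕ) (ρ : Resonator) {q : ℕ} (hq : 1 ≤ q)
    (hT : 4 * π * w.σ / Real.log 2 < ρ.T q) (χ : DirichletCharacter ℂ q) {J₁ J₂ J₃ : ℕ}
    (hJ₁ : (⌈lengthL q * Real.exp (4 * π * w.σ / ρ.T q)⌉₊ : ℝ) ≤ Real.sqrt 2 ^ J₁)
    (hJ₂ : (⌊lengthL q⌋₊ : ℝ) ≤ Real.sqrt 2 ^ J₂)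
    (hJ₃ : 8 * π * w.σ * Real.sqrt 2 ^ J₁ * Real.sqrt 2 ^ J₂ / ρ.T q ≤ Real.sqrt 2 ^ J₃) :
    offDiagOD c w B ρ χ =
      ∑ i ∈ Finset.range (J₁ + 1), ∑ j ∈ Finset.range (J₂ + 1), ∑ l ∈ Finset.range (J₃ + 1),
        (odBoxPos c w B ρ χ (Real.sqrt 2 ^ ((i : ℤ) - 1)) (Real.sqrt 2 ^ ((j : ℤ) - 1))
            (Real.sqrt 2 ^ ((l : ℤ) - 1)) +
          odBoxNeg c w B ρ χ (Real.sqrt 2 ^ ((i : ℤ) - 1)) (Real.sqrt 2 ^ ((j : ℤ) - 1))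
            (Real.sqrt 2 ^ ((l : ℤ) - 1))) := by
  set K₀ : ℕ := ⌈lengthL q * Real.exp (4 * π * w.σ / ρ.T q)⌉₊ with hK₀
  set N : ℕ := ⌊lengthL q⌋₊ with hN
  set Rtop : ℕ := ⌊Real.sqrt 2 ^ J₃⌋₊ with hRtop
  have hs : 0 < Real.sqrt 2 := Real.sqrt_pos.mpr two_pos
  have hT0 : 0 < ρ.T q := resonatorT_pos ρ hq
  have hσ : 0 < w.σ := w.σ_pos
  have hcut : lengthL q * Real.exp (4 * π * w.σ / ρ.T q) ≤ K₀ := Nat.le_ceil _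
  -- the shift cut-offs on the box `k ≤ K₀`, `m ≤ N` are `≤ Rtop`
  have hshift : ∀ k m : ℕ, k ≤ K₀ → m ≤ N →
      8 * π * w.σ * ((k * m : ℕ) : ℝ) / ρ.T q ≤ Real.sqrt 2 ^ J₃ := by
    intro k m hk hm
    have hk' : (k : ℝ) ≤ Real.sqrt 2 ^ J₁ := le_trans (by exact_mod_cast hk) hJ₁
    have hm' : (m : ℝ) ≤ Real.sqrt 2 ^ J₂ := le_trans (by exact_mod_cast hm) hJ₂
    have hkm : ((k * m : ℕ) : ℝ) ≤ Real.sqrt 2 ^ J₁ * Real.sqrt 2 ^ J₂ := by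
      push_cast
      exact mul_le_mul hk' hm' (by positivity) (by positivity)
    refine le_trans ?_ hJ₃
    rw [div_le_div_iff_of_pos_right hT0]
    calc 8 * π * w.σ * ((k * m : ℕ) : ℝ) ≤ 8 * π * w.σ * (Real.sqrt 2 ^ J₁ * Real.sqrt 2 ^ J₂) :=
          mul_le_mul_of_nonneg_left hkm (by positivity)
      _ = 8 * π * w.σ * Real.sqrt 2 ^ J₁ * Real.sqrt 2 ^ J₂ := by ring
  have hR : ∀ k ∈ Icc 1 K₀, ∀ m ∈ Icc 1 N,
      ⌊8 * π * w.σ * ((k * m : ℕ) : ℝ) / ρ.T q⌋₊ ≤ Rtop := by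
    intro k hk m hm
    exact Nat.floor_le_floor (hshift k m (Finset.mem_Icc.mp hk).2 (Finset.mem_Icc.mp hm).2)
  rw [offDiagOD_eq_sum_uniform c w B ρ hq hT χ hR]
  -- insert the three partitions of unity
  have hK : ∀ k ∈ Icc 1 K₀, (1 : ℝ) ≤ k ∧ (k : ℝ) ≤ Real.sqrt 2 ^ J₁ := fun k hk =>
    ⟨by exact_mod_cast (Finset.mem_Icc.mp hk).1,
      le_trans (by exact_mod_cast (Finset.mem_Icc.mp hk).2) hJ₁⟩
  have hM : ∀ m ∈ Icc 1 N, (1 : ℝ) ≤ m ∧ (m : ℝ) ≤ Real.sqrt 2 ^ J₂ := fun m hm =>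
    ⟨by exact_mod_cast (Finset.mem_Icc.mp hm).1,
      le_trans (by exact_mod_cast (Finset.mem_Icc.mp hm).2) hJ₂⟩
  have hRr : ∀ r ∈ Icc 1 Rtop, (1 : ℝ) ≤ r ∧ (r : ℝ) ≤ Real.sqrt 2 ^ J₃ := fun r hr =>
    ⟨by exact_mod_cast (Finset.mem_Icc.mp hr).1,
      le_trans (by exact_mod_cast (Finset.mem_Icc.mp hr).2) (Nat.floor_le (by positivity))⟩
  rw [sum_sum_sum_eq_sum_boxes (Icc 1 K₀) (Icc 1 N) (Icc 1 Rtop) (odPhi c w B ρ χ) hK hM hRr]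
  refine Finset.sum_congr rfl fun i _ => Finset.sum_congr rfl fun j _ =>
    Finset.sum_congr rfl fun l _ => ?_
  rw [odBoxPos_add_odBoxNeg]
  set K : ℝ := Real.sqrt 2 ^ ((i : ℤ) - 1) with hKdef
  set M : ℝ := Real.sqrt 2 ^ ((j : ℤ) - 1) with hMdef
  set R : ℝ := Real.sqrt 2 ^ ((l : ℤ) - 1) with hRdef
  have hKp : 0 < K := zpow_pos hs _
  have hMp : 0 < M := zpow_pos hs _
  have hRp : 0 < R := zpow_pos hs _
  -- shrink the `k`-range
  rw [sum_eq_sum_of_eq_zero_off (s := Icc 1 K₀) (t := Icc 1 ⌊2 * K⌋₊)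
    (f := fun k => ∑ m ∈ Icc 1 N, ∑ r ∈ Icc 1 Rtop,
      bump ((k : ℝ) / K) ^ 2 * bump ((m : ℝ) / M) ^ 2 * bump ((r : ℝ) / R) ^ 2 *
        odPhi c w B ρ χ k m r)]
  rotate_left
  · intro k hk hk'
    simp only [Finset.mem_Icc, not_and, not_le] at hk hk'
    have hb : bump ((k : ℝ) / K) = 0 := bump_div_eq_zero_of_floor_lt hKp (hk' hk.1)
    simp [hb]
  · intro k hk hk'
    simp only [Finset.mem_Icc, not_and, not_le] at hk hk'
    have hkK : lengthL q * Real.exp (4 * π * w.σ / ρ.T q) < k :=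
      lt_of_le_of_lt hcut (by exact_mod_cast hk' hk.1)
    refine Finset.sum_eq_zero fun m hm => Finset.sum_eq_zero fun r _ => ?_
    rw [odPhi_eq_zero_of_cutoff_lt c w B ρ hq χ (Finset.mem_Icc.mp hm).1 hkK r, mul_zero]
  refine Finset.sum_congr rfl fun k hk => ?_
  have hk1 : 1 ≤ k := (Finset.mem_Icc.mp hk).1
  -- shrink the `m`-range
  rw [sum_eq_sum_of_eq_zero_off (s := Icc 1 N) (t := Icc 1 ⌊2 * M⌋₊)
    (f := fun m => ∑ r ∈ Icc 1 Rtop,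
      bump ((k : ℝ) / K) ^ 2 * bump ((m : ℝ) / M) ^ 2 * bump ((r : ℝ) / R) ^ 2 *
        odPhi c w B ρ χ k m r)]
  rotate_left
  · intro m hm hm'
    simp only [Finset.mem_Icc, not_and, not_le] at hm hm'
    have hb : bump ((m : ℝ) / M) = 0 := bump_div_eq_zero_of_floor_lt hMp (hm' hm.1)
    simp [hb]
  · intro m hm hm'
    simp only [Finset.mem_Icc, not_and, not_le] at hm hm'
    have hmL : lengthL q < m := Nat.lt_of_floor_lt (hm' hm.1)
    refine Finset.sum_eq_zero fun r _ => ?_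
    rw [odPhi_eq_zero_of_lengthL_lt c w B ρ hq χ hmL k r, mul_zero]
  refine Finset.sum_congr rfl fun m hm => ?_
  have hm1 : 1 ≤ m := (Finset.mem_Icc.mp hm).1
  have hkm : 1 ≤ k * m := Nat.one_le_iff_ne_zero.mpr (Nat.mul_ne_zero (by omega) (by omega))
  -- shrink the `r`-range
  refine sum_eq_sum_of_eq_zero_off (fun r hr hr' => ?_) (fun r hr hr' => ?_)
  · simp only [Finset.mem_Icc, not_and, not_le] at hr hr'
    have hb : bump ((r : ℝ) / R) = 0 := bump_div_eq_zero_of_floor_lt hRp (hr' hr.1)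
    simp [hb]
  · simp only [Finset.mem_Icc, not_and, not_le] at hr hr'
    have hRr' : Rtop < r := hr' hr.1
    by_cases hkK : K₀ < k
    · have hkK' : lengthL q * Real.exp (4 * π * w.σ / ρ.T q) < k :=
        lt_of_le_of_lt hcut (by exact_mod_cast hkK)
      rw [odPhi_eq_zero_of_cutoff_lt c w B ρ hq χ hm1 hkK' r, mul_zero]
    by_cases hmN : N < m
    · rw [odPhi_eq_zero_of_lengthL_lt c w B ρ hq χ (Nat.lt_of_floor_lt hmN) k r, mul_zero]
    push Not at hkK hmN
    have h1 : 8 * π * w.σ * ((k * m : ℕ) : ℝ) / ρ.T q < r :=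
      lt_of_le_of_lt (hshift k m hkK hmN) (Nat.lt_of_floor_lt hRr')
    rw [div_lt_iff₀ hT0] at h1
    rw [odPhi_eq_zero_of_shift_lt c w B ρ hT χ hkm h1, mul_zero]

/-! ### Contributing boxes have primed-admissible scales -/

/-- The ratio-`√2` scales `√2^{i−1} ≥ 1/√2 ≥ 1/2` clear the floor of `IsAdmissibleScale'`
(G-ah-9b). [cite: BondarenkoHeap2026, §6.2, TeX l.834–840] -/
theorem half_le_sqrt_two_zpow (i : ℕ) : (2 : ℝ)⁻¹ ≤ Real.sqrt 2 ^ ((i : ℤ) - 1) := by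
  have hs : 0 < Real.sqrt 2 := Real.sqrt_pos.mpr two_pos
  have hs1 : 1 ≤ Real.sqrt 2 := by
    have := Real.sqrt_le_sqrt (show (1 : ℝ) ≤ 2 by norm_num)
    rwa [Real.sqrt_one] at this
  have hs2 : Real.sqrt 2 ≤ 2 := by
    nlinarith [Real.sq_sqrt (show (0 : ℝ) ≤ 2 by norm_num), Real.sqrt_nonneg 2]
  calc (2 : ℝ)⁻¹ ≤ (Real.sqrt 2)⁻¹ := inv_anti₀ hs hs2
    _ = Real.sqrt 2 ^ (-1 : ℤ) := by rw [zpow_neg_one]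
    _ ≤ Real.sqrt 2 ^ ((i : ℤ) - 1) := zpow_le_zpow_right₀ hs1 (by omega)

/-- A nonzero term forces `n ≤ L` (`r(n) = 0` beyond `L`). [cite: BondarenkoHeap2026, §2.3 p. 8] -/
theorem le_lengthL_of_jTerm_ne_zero (c : ℝ) (w : Bump) (B : ℕ) (ρ : Resonator) {q : ℕ} (hq : 1 ≤ q)
    (χ : DirichletCharacter ℂ q) {k m n : ℕ} (h : jTerm c w B (ρ.coeff χ) (ρ.T q) k m n ≠ 0) :
    (n : ℝ) ≤ lengthL q := by
  by_contra hn
  have hc := coeff_eq_zero_of_lengthL_lt ρ hq χ (lt_of_not_ge hn)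
  exact h (by simp [jTerm, hc])

/-- **A contributing box is admissible** ("Note that from the support of `Ŵ` we have the
restrictions `R ≪ KM/T, KM ≪ L`", TeX l.766; the explicit constants are ours): if the box at
scales `K = √2^{i−1}`, `M = √2^{j−1}`, `R = √2^{l−1}` has a nonzero sum (either sign of the
shift), then `R ≤ 32πσ·KM/T` and `KM ≤ 3L`,
i.e. `IsAdmissibleScale' q δ C₀ K M R` with `C₀ = max(32πσ, 3)` (`T > 4πσ/log 2`). So the
power-saving hypothesis `CorrSumPowerSaving'` is only ever applied on admissible boxes; the others
contribute `0`. [cite: BondarenkoHeap2026, §6.2, TeX l.766–770] -/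
theorem isAdmissibleScale'_of_odBox_ne_zero (c : ℝ) (w : Bump) (B : ℕ) (ρ : Resonator) {q : ℕ}
    (hq : 1 ≤ q) (hT : 4 * π * w.σ / Real.log 2 < ρ.T q) (χ : DirichletCharacter ℂ q)
    (i j l : ℕ)
    (h : odBoxPos c w B ρ χ (Real.sqrt 2 ^ ((i : ℤ) - 1)) (Real.sqrt 2 ^ ((j : ℤ) - 1))
          (Real.sqrt 2 ^ ((l : ℤ) - 1)) ≠ 0 ∨
        odBoxNeg c w B ρ χ (Real.sqrt 2 ^ ((i : ℤ) - 1)) (Real.sqrt 2 ^ ((j : ℤ) - 1))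
          (Real.sqrt 2 ^ ((l : ℤ) - 1)) ≠ 0) :
    IsAdmissibleScale' q ρ.δ (max (32 * π * w.σ) 3) (Real.sqrt 2 ^ ((i : ℤ) - 1))
      (Real.sqrt 2 ^ ((j : ℤ) - 1)) (Real.sqrt 2 ^ ((l : ℤ) - 1)) := by
  set K : ℝ := Real.sqrt 2 ^ ((i : ℤ) - 1) with hKdef
  set M : ℝ := Real.sqrt 2 ^ ((j : ℤ) - 1) with hMdef
  set R : ℝ := Real.sqrt 2 ^ ((l : ℤ) - 1) with hRdef
  set C₀ : ℝ := max (32 * π * w.σ) 3 with hC₀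
  have hs : 0 < Real.sqrt 2 := Real.sqrt_pos.mpr two_pos
  have hKp : 0 < K := zpow_pos hs _
  have hMp : 0 < M := zpow_pos hs _
  have hRp : 0 < R := zpow_pos hs _
  have hσ : 0 < w.σ := w.σ_pos
  have hT0 : 0 < ρ.T q := resonatorT_pos ρ hq
  have hL0 : 0 ≤ lengthL q := by unfold lengthL; positivity
  have hC₀1 : 32 * π * w.σ ≤ C₀ := le_max_left _ _
  have hC₀3 : (3 : ℝ) ≤ C₀ := le_max_right _ _
  have hlog2 : Real.log 2 < 1 := by
    have := Real.log_two_lt_d9; linarith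
  have hlog2' : 0 < Real.log 2 := Real.log_pos one_lt_two
  -- `8πσ/T < 2 log 2 < 2`
  have h8 : 8 * π * w.σ < 2 * ρ.T q := by
    have h1 : 4 * π * w.σ < ρ.T q * Real.log 2 := by rwa [div_lt_iff₀ hlog2'] at hT
    nlinarith
  -- the common conclusion from a nonzero term in the window
  have key : ∀ k m r n : ℕ, K ≤ k → (k : ℝ) ≤ 2 * K → M ≤ m → (m : ℝ) ≤ 2 * M → R ≤ r →
      (n : ℝ) ≤ lengthL q → (r : ℝ) * ρ.T q ≤ 8 * π * w.σ * ((k * m : ℕ) : ℝ) →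
      ((k * m : ℕ) : ℝ) ≤ 3 * n → IsAdmissibleScale' q ρ.δ C₀ K M R := by
    intro k m r n hKk hk2 hMm hm2 hRr hnL hrT hkmn
    have hkm4 : ((k * m : ℕ) : ℝ) ≤ 4 * (K * M) := by
      push_cast
      calc (k : ℝ) * m ≤ (2 * K) * (2 * M) := mul_le_mul hk2 hm2 (by positivity) (by positivity)
        _ = 4 * (K * M) := by ring
    have hKMkm : K * M ≤ ((k * m : ℕ) : ℝ) := by
      push_cast
      exact mul_le_mul hKk hMm hMp.le (by positivity)
    refine ⟨half_le_sqrt_two_zpow i, half_le_sqrt_two_zpow j, half_le_sqrt_two_zpow l, ?_, ?_⟩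
    · -- `R ≤ r ≤ 8πσ km/T ≤ 32πσ KM/T ≤ C₀ KM/T`
      show R ≤ C₀ * (K * M) / ρ.T q
      rw [le_div_iff₀ hT0]
      calc R * ρ.T q ≤ r * ρ.T q := mul_le_mul_of_nonneg_right hRr hT0.le
        _ ≤ 8 * π * w.σ * ((k * m : ℕ) : ℝ) := hrT
        _ ≤ 8 * π * w.σ * (4 * (K * M)) := mul_le_mul_of_nonneg_left hkm4 (by positivity)
        _ = 32 * π * w.σ * (K * M) := by ring
        _ ≤ C₀ * (K * M) := mul_le_mul_of_nonneg_right hC₀1 (by positivity)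
    · -- `KM ≤ km ≤ 3n ≤ 3L ≤ C₀ L`
      show K * M ≤ C₀ * lengthL q
      calc K * M ≤ ((k * m : ℕ) : ℝ) := hKMkm
        _ ≤ 3 * n := hkmn
        _ ≤ 3 * lengthL q := by linarith
        _ ≤ C₀ * lengthL q := mul_le_mul_of_nonneg_right hC₀3 hL0
  rcases h with h | h
  · -- positive shifts
    obtain ⟨k, hk, h1⟩ := Finset.exists_ne_zero_of_sum_ne_zero h
    obtain ⟨m, hm, h2⟩ := Finset.exists_ne_zero_of_sum_ne_zero h1
    obtain ⟨r, hr, h3⟩ := Finset.exists_ne_zero_of_sum_ne_zero h2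
    simp only [ne_eq, mul_eq_zero, not_or, pow_eq_zero_iff, OfNat.ofNat_ne_zero,
      not_false_eq_true] at h3
    obtain ⟨⟨⟨hbk, hbm⟩, hbr⟩, hj⟩ := h3
    obtain ⟨hKk, hk2⟩ := bump_div_ne_zero_imp hKp hbk
    obtain ⟨hMm, hm2⟩ := bump_div_ne_zero_imp hMp hbm
    obtain ⟨hRr, -⟩ := bump_div_ne_zero_imp hRp hbr
    have hk1 : 1 ≤ k := (Finset.mem_Icc.mp hk).1
    have hm1 : 1 ≤ m := (Finset.mem_Icc.mp hm).1
    have hkm : 1 ≤ k * m := Nat.one_le_iff_ne_zero.mpr (Nat.mul_ne_zero (by omega) (by omega))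
    have hnL := le_lengthL_of_jTerm_ne_zero c w B ρ hq χ hj
    have hrT : (r : ℝ) * ρ.T q ≤ 8 * π * w.σ * ((k * m : ℕ) : ℝ) := by
      by_contra hlt
      exact hj (jTerm_shift_eq_zero c w B (ρ.coeff χ) hT hkm (lt_of_not_ge hlt))
    refine key k m r (k * m + r) hKk hk2 hMm hm2 hRr hnL hrT ?_
    push_cast
    nlinarith [Nat.cast_nonneg (α := ℝ) r, Nat.cast_nonneg (α := ℝ) (k * m)]
  · -- negative shifts
    obtain ⟨k, hk, h1⟩ := Finset.exists_ne_zero_of_sum_ne_zero h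
    obtain ⟨m, hm, h2⟩ := Finset.exists_ne_zero_of_sum_ne_zero h1
    obtain ⟨r, hr, h3⟩ := Finset.exists_ne_zero_of_sum_ne_zero h2
    simp only [ne_eq, mul_eq_zero, not_or, pow_eq_zero_iff, OfNat.ofNat_ne_zero,
      not_false_eq_true] at h3
    obtain ⟨⟨⟨hbk, hbm⟩, hbr⟩, hj⟩ := h3
    obtain ⟨hKk, hk2⟩ := bump_div_ne_zero_imp hKp hbk
    obtain ⟨hMm, hm2⟩ := bump_div_ne_zero_imp hMp hbm
    obtain ⟨hRr, -⟩ := bump_div_ne_zero_imp hRp hbr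
    have hr1 : 1 ≤ r := (Finset.mem_Icc.mp hr).1
    split_ifs at hj with hlt
    · have hnL := le_lengthL_of_jTerm_ne_zero c w B ρ hq χ hj
      have hn1 : 1 ≤ k * m - r := by omega
      have hrT' : (r : ℝ) * ρ.T q ≤ 8 * π * w.σ * ((k * m - r : ℕ) : ℝ) := by
        by_contra hlt'
        exact hj (jTerm_eq_zero_of_neg_shift c w B (ρ.coeff χ) hT (n := k * m - r) (r := r)
          hn1 (by omega) (lt_of_not_ge hlt'))
      have hsub : ((k * m - r : ℕ) : ℝ) = ((k * m : ℕ) : ℝ) - r := by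
        rw [Nat.cast_sub hlt.le]
      have hrT : (r : ℝ) * ρ.T q ≤ 8 * π * w.σ * ((k * m : ℕ) : ℝ) := by
        rw [hsub] at hrT'
        have : (0 : ℝ) ≤ 8 * π * w.σ * r := by positivity
        linarith
      refine key k m r (k * m - r) hKk hk2 hMm hm2 hRr hnL hrT ?_
      -- `km = n + r ≤ n + 8πσ n/T ≤ 3n`
      rw [hsub] at hrT' ⊢
      have hn0 : (0 : ℝ) ≤ ((k * m : ℕ) : ℝ) - r := by
        rw [← hsub]; exact Nat.cast_nonneg _
      -- `r T ≤ 8πσ (km − r)` and `8πσ < 2T` give `r T ≤ 2T (km − r)`, so `r ≤ 2 (km − r)`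
      have h1 : (r : ℝ) * ρ.T q ≤ 2 * ρ.T q * (((k * m : ℕ) : ℝ) - r) := by
        nlinarith
      have h2 : (r : ℝ) ≤ 2 * (((k * m : ℕ) : ℝ) - r) := by
        by_contra hcon
        push Not at hcon
        nlinarith
      linarith
    · exact absurd rfl hj

/-- **(T2′) Only boxes with `K ≥ √2` contribute** (`Λ(0) = Λ(1) = 0`, and the window of
`bump(·/K)` is the OPEN interval `(K, 2K)`): a nonzero box sum at `K = √2^{i−1}` forces `2 ≤ i`,
i.e. `√2 ≤ K` (so in particular `1 ≤ K`, the unprimed floor, on every contributing box). Our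
bookkeeping; the print only says "`k ≪ L`". [cite: BondarenkoHeap2026, §6.2, TeX l.745] -/
theorem sqrt_two_le_of_odBox_ne_zero (c : ℝ) (w : Bump) (B : ℕ) (ρ : Resonator) {q : ℕ}
    (χ : DirichletCharacter ℂ q) (i : ℕ) {M R : ℝ}
    (h : odBoxPos c w B ρ χ (Real.sqrt 2 ^ ((i : ℤ) - 1)) M R ≠ 0 ∨
        odBoxNeg c w B ρ χ (Real.sqrt 2 ^ ((i : ℤ) - 1)) M R ≠ 0) :
    Real.sqrt 2 ≤ Real.sqrt 2 ^ ((i : ℤ) - 1) := by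
  set K : ℝ := Real.sqrt 2 ^ ((i : ℤ) - 1) with hKdef
  have hs : 0 < Real.sqrt 2 := Real.sqrt_pos.mpr two_pos
  have hs1 : 1 ≤ Real.sqrt 2 := by
    have := Real.sqrt_le_sqrt (show (1 : ℝ) ≤ 2 by norm_num)
    rwa [Real.sqrt_one] at this
  have hKp : 0 < K := zpow_pos hs _
  -- a term with `bump(k/K) ≠ 0` and `Λ(k) ≠ 0`
  have hex : ∃ k : ℕ, bump ((k : ℝ) / K) ≠ 0 ∧ Λ k ≠ 0 := by
    rcases h with h | h
    · obtain ⟨k, -, h1⟩ := Finset.exists_ne_zero_of_sum_ne_zero h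
      obtain ⟨m, -, h2⟩ := Finset.exists_ne_zero_of_sum_ne_zero h1
      obtain ⟨r, -, h3⟩ := Finset.exists_ne_zero_of_sum_ne_zero h2
      simp only [ne_eq, mul_eq_zero, not_or, pow_eq_zero_iff, OfNat.ofNat_ne_zero,
        not_false_eq_true] at h3
      refine ⟨k, h3.1.1.1, fun hΛ => h3.2 ?_⟩
      simp [jTerm, hΛ]
    · obtain ⟨k, -, h1⟩ := Finset.exists_ne_zero_of_sum_ne_zero h
      obtain ⟨m, -, h2⟩ := Finset.exists_ne_zero_of_sum_ne_zero h1
      obtain ⟨r, -, h3⟩ := Finset.exists_ne_zero_of_sum_ne_zero h2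
      simp only [ne_eq, mul_eq_zero, not_or, pow_eq_zero_iff, OfNat.ofNat_ne_zero,
        not_false_eq_true] at h3
      refine ⟨k, h3.1.1.1, fun hΛ => h3.2 ?_⟩
      simp [jTerm, hΛ]
  obtain ⟨k, hbk, hΛ⟩ := hex
  -- `Λ(k) ≠ 0 ⇒ k ≥ 2`
  have hk2 : (2 : ℝ) ≤ k := by
    have : 2 ≤ k := by
      by_contra hlt
      push Not at hlt
      interval_cases k
      · exact hΛ (by simp)
      · exact hΛ ArithmeticFunction.vonMangoldt_apply_one
    exact_mod_cast this
  -- `k/K < 2 ⇒ K > 1 ⇒ i ≥ 2`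
  obtain ⟨-, hlt⟩ := bump_ne_zero_imp hbk
  rw [div_lt_iff₀ hKp] at hlt
  have hK1 : 1 < K := by linarith
  have hi : (1 : ℤ) ≤ (i : ℤ) - 1 := by
    by_contra hcon
    push Not at hcon
    have : K ≤ 1 := zpow_le_one_of_nonpos₀ hs1 (by omega)
    linarith
  calc Real.sqrt 2 = Real.sqrt 2 ^ (1 : ℤ) := (zpow_one _).symm
    _ ≤ K := zpow_le_zpow_right₀ hs1 hi

/-! ### The partition weight `bump²` as a complex profile: all-order derivative bounds -/

/-- `ω²` is smooth. [cite: BondarenkoHeap2026, §6.2, TeX l.750–753] -/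
theorem bump_sq_contDiff : ContDiff ℝ ∞ fun x : ℝ => bump x ^ 2 :=
  bump_contDiff.pow 2

/-- `ω²` has compact support. [cite: BondarenkoHeap2026, §6.2, TeX l.750–753] -/
theorem hasCompactSupport_bump_sq : HasCompactSupport fun x : ℝ => bump x ^ 2 := by
  have h : HasCompactSupport (bump * bump) := hasCompactSupport_bump.mul_right
  have he : (fun x : ℝ => bump x ^ 2) = bump * bump := by
    funext x; simp [pow_two]
  rw [he]; exact h

/-- Each derivative of `ω²` is bounded. [cite: BondarenkoHeap2026, §6.2, TeX l.834–836] -/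
theorem exists_bound_iteratedDeriv_bump_sq (j : ℕ) :
    ∃ C : ℝ, 0 ≤ C ∧ ∀ x : ℝ, ‖iteratedDeriv j (fun y : ℝ => bump y ^ 2) x‖ ≤ C := by
  have hc : Continuous (iteratedDeriv j fun y : ℝ => bump y ^ 2) :=
    bump_sq_contDiff.continuous_iteratedDeriv j (by exact_mod_cast le_top)
  have hsupp : HasCompactSupport (iteratedDeriv j fun y : ℝ => bump y ^ 2) := by
    refine (hasCompactSupport_bump_sq.iteratedFDeriv (𝕜 := ℝ) j).mono ?_
    intro x hx
    rw [Function.mem_support] at hx ⊢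
    intro h0
    apply hx
    simp [iteratedDeriv_eq_iteratedFDeriv, h0]
  obtain ⟨C, hC⟩ := hc.bounded_above_of_compact_support hsupp
  exact ⟨max C 0, le_max_right _ _, fun x => (hC x).trans (le_max_left _ _)⟩

/-- Iterated derivatives commute with `ℝ → ℂ` for a smooth real function. [folklore] -/
private theorem iteratedDeriv_ofReal_comp' {f : ℝ → ℝ} (hf : ContDiff ℝ ∞ f) (j : ℕ) (x : ℝ) :
    iteratedDeriv j (fun y : ℝ => (f y : ℂ)) x = ((iteratedDeriv j f x : ℝ) : ℂ) := by
  induction j generalizing f x with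
  | zero => simp
  | succ j ih =>
    rw [iteratedDeriv_succ', iteratedDeriv_succ']
    have hd : ∀ y, HasDerivAt f (deriv f y) y := fun y =>
      (hf.differentiable (by simp)).differentiableAt.hasDerivAt
    have hderiv : deriv (fun y : ℝ => (f y : ℂ)) = fun y => ((deriv f y : ℝ) : ℂ) := by
      funext y
      exact (hd y).ofReal_comp.deriv
    rw [hderiv]
    exact ih (contDiff_infty_iff_deriv.1 hf).2 x

/-- **Each derivative of the complex profile `y ↦ (ω(y)² : ℂ)` is bounded** (the profile of the
separated weight `γ(x) = ω(x/R)²(x/R)^{−z}` of the `r`-variable, L3b).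
[cite: BondarenkoHeap2026, §6.2, TeX l.834–836] -/
theorem exists_bound_iteratedDeriv_bump_sq_ofReal (j : ℕ) :
    ∃ C : ℝ, 0 ≤ C ∧ ∀ y : ℝ, ‖iteratedDeriv j (fun y : ℝ => ((bump y ^ 2 : ℝ) : ℂ)) y‖ ≤ C := by
  obtain ⟨C, hC0, hC⟩ := exists_bound_iteratedDeriv_bump_sq j
  refine ⟨C, hC0, fun y => ?_⟩
  rw [iteratedDeriv_ofReal_comp' bump_sq_contDiff, Complex.norm_real]
  exact hC y

/-- `|ω(y)²| ≤ 1`. [cite: BondarenkoHeap2026, §6.2, TeX l.834] -/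
theorem norm_bump_sq_ofReal_le_one (y : ℝ) : ‖((bump y ^ 2 : ℝ) : ℂ)‖ ≤ 1 := by
  rw [Complex.norm_real, Real.norm_eq_abs, abs_of_nonneg (sq_nonneg _)]
  have h0 := bump_nonneg y
  have h1 := bump_le_one y
  nlinarith

/-- **One family of derivative constants for `ω²`, with `A 0 ≤ 1`** (so that a separated weight
built on `ω²` lies in `IsSmoothDyadicWeight'` with a single family, as `CorrSumBoundOn'` wants).
[cite: BondarenkoHeap2026, §6.2, TeX l.834–836] -/
theorem exists_family_iteratedDeriv_bump_sq_ofReal :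
    ∃ A : ℕ → ℝ, A 0 ≤ 1 ∧ (∀ j, 0 ≤ A j) ∧
      ∀ (j : ℕ) (y : ℝ), ‖iteratedDeriv j (fun y : ℝ => ((bump y ^ 2 : ℝ) : ℂ)) y‖ ≤ A j := by
  choose C hC0 hC using exists_bound_iteratedDeriv_bump_sq_ofReal
  refine ⟨fun j => if j = 0 then 1 else C j, by simp, fun j => ?_, fun j y => ?_⟩
  · by_cases hj : j = 0 <;> simp [hj, hC0]
  · by_cases hj : j = 0
    · subst hj
      simpa using norm_bump_sq_ofReal_le_one y
    · simpa [hj] using hC j y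

/-! ### The number of boxes -/

/-- **Box indices exist with `J ≪ log`** ("summing the `≪ (log T)^{O(1)}` partitions", TeX
l.845): there are `J₁, J₂, J₃` meeting the hypotheses of `offDiagOD_eq_sum_boxes`, each at most
`2 log(Y)/log 2 + 1` for its covering bound `Y` (`SmoothDyadicPartition.exists_cover_index`), so the
number of boxes `2(J₁+1)(J₂+1)(J₃+1)` is `≪_σ (log q)³`.
[cite: BondarenkoHeap2026, §6.2, TeX l.845] -/
theorem exists_box_indices (w : Bump) (ρ : Resonator) {q : ℕ} (hq : 1 ≤ q) :
    ∃ J₁ J₂ J₃ : ℕ,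
      (⌈lengthL q * Real.exp (4 * π * w.σ / ρ.T q)⌉₊ : ℝ) ≤ Real.sqrt 2 ^ J₁ ∧
      (⌊lengthL q⌋₊ : ℝ) ≤ Real.sqrt 2 ^ J₂ ∧
      8 * π * w.σ * Real.sqrt 2 ^ J₁ * Real.sqrt 2 ^ J₂ / ρ.T q ≤ Real.sqrt 2 ^ J₃ ∧
      (J₁ : ℝ) ≤ 2 * Real.log (⌈lengthL q * Real.exp (4 * π * w.σ / ρ.T q)⌉₊ : ℕ) / Real.log 2 + 1 ∧
      (J₂ : ℝ) ≤ 2 * Real.log (max 1 (⌊lengthL q⌋₊ : ℝ)) / Real.log 2 + 1 ∧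
      (J₃ : ℝ) ≤ 2 * Real.log (max 1 (8 * π * w.σ * Real.sqrt 2 ^ J₁ * Real.sqrt 2 ^ J₂ / ρ.T q)) /
        Real.log 2 + 1 := by
  have hL0 : 0 < lengthL q := by
    unfold lengthL; exact Real.rpow_pos_of_pos (by exact_mod_cast hq) _
  -- `K₀ ≥ 1`
  have hK₀ : (1 : ℝ) ≤ (⌈lengthL q * Real.exp (4 * π * w.σ / ρ.T q)⌉₊ : ℕ) := by
    have h1 : 1 ≤ ⌈lengthL q * Real.exp (4 * π * w.σ / ρ.T q)⌉₊ :=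
      Nat.one_le_iff_ne_zero.mpr (Nat.ceil_pos.mpr (mul_pos hL0 (Real.exp_pos _))).ne'
    exact_mod_cast h1
  obtain ⟨J₁, hJ₁, hJ₁'⟩ := exists_cover_index hK₀
  obtain ⟨J₂, hJ₂, hJ₂'⟩ := exists_cover_index (le_max_left 1 (⌊lengthL q⌋₊ : ℝ))
  obtain ⟨J₃, hJ₃, hJ₃'⟩ := exists_cover_index
    (le_max_left 1 (8 * π * w.σ * Real.sqrt 2 ^ J₁ * Real.sqrt 2 ^ J₂ / ρ.T q))
  exact ⟨J₁, J₂, J₃, hJ₁, (le_max_right _ _).trans hJ₂, (le_max_right _ _).trans hJ₃, hJ₁', hJ₂',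
    hJ₃'⟩

/-! ### The fourth partition, in `n = km ± r` (for the Mellin separation of `G(n)n^{−1/2}`) -/

/-- **Partition of unity in the product variable `n = km + r` inside a box**: for `√2^{J₄} ≥ L`,
`odBoxPos(K,M,R) = Σ_{ν ≤ J₄} Σ_{k,m,r} ω(k/K)²ω(m/M)²ω(r/R)² · ω((km+r)/√2^{ν−1})² ·
jTerm(k,m,km+r)`
— a vanishing `jTerm` needs no partition, a nonzero one has `1 ≤ km + r ≤ L ≤ √2^{J₄}`
(`le_lengthL_of_jTerm_ne_zero`, `sum_range_bump_sq_eq_one`). Our bookkeeping for the sibling's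
Mellin separation of `G(n)n^{−1/2}` in the single variable `n/N` (cell design of 12:03Z).
[cite: BondarenkoHeap2026, §6.2, TeX l.751–766] -/
theorem odBoxPos_eq_sum_partition_n (c : ℝ) (w : Bump) (B : ℕ) (ρ : Resonator) {q : ℕ}
    (hq : 1 ≤ q) (χ : DirichletCharacter ℂ q) {J₄ : ℕ} (hJ₄ : lengthL q ≤ Real.sqrt 2 ^ J₄)
    (K M R : ℝ) :
    odBoxPos c w B ρ χ K M R = ∑ ν ∈ Finset.range (J₄ + 1),
      ∑ k ∈ Icc 1 ⌊2 * K⌋₊, ∑ m ∈ Icc 1 ⌊2 * M⌋₊, ∑ r ∈ Icc 1 ⌊2 * R⌋₊,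
        bump ((k : ℝ) / K) ^ 2 * bump ((m : ℝ) / M) ^ 2 * bump ((r : ℝ) / R) ^ 2 *
          (bump (((k * m + r : ℕ) : ℝ) / Real.sqrt 2 ^ ((ν : ℤ) - 1)) ^ 2 *
            jTerm c w B (ρ.coeff χ) (ρ.T q) k m (k * m + r)) := by
  -- termwise: a vanishing `jTerm` needs no partition, a nonzero one has `1 ≤ n ≤ L ≤ √2^{J₄}`
  have hterm : ∀ k m r : ℕ, 1 ≤ r →
      jTerm c w B (ρ.coeff χ) (ρ.T q) k m (k * m + r) =
        ∑ ν ∈ Finset.range (J₄ + 1),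
          bump (((k * m + r : ℕ) : ℝ) / Real.sqrt 2 ^ ((ν : ℤ) - 1)) ^ 2 *
            jTerm c w B (ρ.coeff χ) (ρ.T q) k m (k * m + r) := by
    intro k m r hr
    rw [← Finset.sum_mul]
    by_cases hj : jTerm c w B (ρ.coeff χ) (ρ.T q) k m (k * m + r) = 0
    · simp [hj]
    · have hn1 : (1 : ℝ) ≤ ((k * m + r : ℕ) : ℝ) := by
        have : 1 ≤ k * m + r := le_add_left hr
        exact_mod_cast this
      have hnL := (le_lengthL_of_jTerm_ne_zero c w B ρ hq χ hj).trans hJ₄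
      rw [sum_range_bump_sq_eq_one hn1 hnL, one_mul]
  calc odBoxPos c w B ρ χ K M R
      = ∑ k ∈ Icc 1 ⌊2 * K⌋₊, ∑ m ∈ Icc 1 ⌊2 * M⌋₊, ∑ r ∈ Icc 1 ⌊2 * R⌋₊,
          ∑ ν ∈ Finset.range (J₄ + 1),
            bump ((k : ℝ) / K) ^ 2 * bump ((m : ℝ) / M) ^ 2 * bump ((r : ℝ) / R) ^ 2 *
              (bump (((k * m + r : ℕ) : ℝ) / Real.sqrt 2 ^ ((ν : ℤ) - 1)) ^ 2 *
                jTerm c w B (ρ.coeff χ) (ρ.T q) k m (k * m + r)) := by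
        unfold odBoxPos
        refine Finset.sum_congr rfl fun k _ => Finset.sum_congr rfl fun m _ =>
          Finset.sum_congr rfl fun r hr => ?_
        rw [← Finset.mul_sum, ← hterm k m r (Finset.mem_Icc.mp hr).1]
    _ = ∑ k ∈ Icc 1 ⌊2 * K⌋₊, ∑ m ∈ Icc 1 ⌊2 * M⌋₊, ∑ ν ∈ Finset.range (J₄ + 1),
          ∑ r ∈ Icc 1 ⌊2 * R⌋₊,
            bump ((k : ℝ) / K) ^ 2 * bump ((m : ℝ) / M) ^ 2 * bump ((r : ℝ) / R) ^ 2 *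
              (bump (((k * m + r : ℕ) : ℝ) / Real.sqrt 2 ^ ((ν : ℤ) - 1)) ^ 2 *
                jTerm c w B (ρ.coeff χ) (ρ.T q) k m (k * m + r)) :=
        Finset.sum_congr rfl fun _ _ => Finset.sum_congr rfl fun _ _ => Finset.sum_comm
    _ = ∑ k ∈ Icc 1 ⌊2 * K⌋₊, ∑ ν ∈ Finset.range (J₄ + 1), ∑ m ∈ Icc 1 ⌊2 * M⌋₊,
          ∑ r ∈ Icc 1 ⌊2 * R⌋₊,
            bump ((k : ℝ) / K) ^ 2 * bump ((m : ℝ) / M) ^ 2 * bump ((r : ℝ) / R) ^ 2 *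
              (bump (((k * m + r : ℕ) : ℝ) / Real.sqrt 2 ^ ((ν : ℤ) - 1)) ^ 2 *
                jTerm c w B (ρ.coeff χ) (ρ.T q) k m (k * m + r)) :=
        Finset.sum_congr rfl fun _ _ => Finset.sum_comm
    _ = _ := Finset.sum_comm

/-- The same for the negative shifts, `n = km − r ≥ 1`.
[cite: BondarenkoHeap2026, §6.2, TeX l.749–766] -/
theorem odBoxNeg_eq_sum_partition_n (c : ℝ) (w : Bump) (B : ℕ) (ρ : Resonator) {q : ℕ}
    (hq : 1 ≤ q) (χ : DirichletCharacter ℂ q) {J₄ : ℕ} (hJ₄ : lengthL q ≤ Real.sqrt 2 ^ J₄)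
    (K M R : ℝ) :
    odBoxNeg c w B ρ χ K M R = ∑ ν ∈ Finset.range (J₄ + 1),
      ∑ k ∈ Icc 1 ⌊2 * K⌋₊, ∑ m ∈ Icc 1 ⌊2 * M⌋₊, ∑ r ∈ Icc 1 ⌊2 * R⌋₊,
        bump ((k : ℝ) / K) ^ 2 * bump ((m : ℝ) / M) ^ 2 * bump ((r : ℝ) / R) ^ 2 *
          (bump (((k * m - r : ℕ) : ℝ) / Real.sqrt 2 ^ ((ν : ℤ) - 1)) ^ 2 *
            (if r < k * m then jTerm c w B (ρ.coeff χ) (ρ.T q) k m (k * m - r) else 0)) := by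
  have hterm : ∀ k m r : ℕ,
      (if r < k * m then jTerm c w B (ρ.coeff χ) (ρ.T q) k m (k * m - r) else 0) =
        ∑ ν ∈ Finset.range (J₄ + 1),
          bump (((k * m - r : ℕ) : ℝ) / Real.sqrt 2 ^ ((ν : ℤ) - 1)) ^ 2 *
            (if r < k * m then jTerm c w B (ρ.coeff χ) (ρ.T q) k m (k * m - r) else 0) := by
    intro k m r
    rw [← Finset.sum_mul]
    split_ifs with hlt
    · by_cases hj : jTerm c w B (ρ.coeff χ) (ρ.T q) k m (k * m - r) = 0
      · simp [hj]
      · have hn1 : (1 : ℝ) ≤ ((k * m - r : ℕ) : ℝ) := by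
          have : 1 ≤ k * m - r := by omega
          exact_mod_cast this
        have hnL := (le_lengthL_of_jTerm_ne_zero c w B ρ hq χ hj).trans hJ₄
        rw [sum_range_bump_sq_eq_one hn1 hnL, one_mul]
    · simp
  calc odBoxNeg c w B ρ χ K M R
      = ∑ k ∈ Icc 1 ⌊2 * K⌋₊, ∑ m ∈ Icc 1 ⌊2 * M⌋₊, ∑ r ∈ Icc 1 ⌊2 * R⌋₊,
          ∑ ν ∈ Finset.range (J₄ + 1),
            bump ((k : ℝ) / K) ^ 2 * bump ((m : ℝ) / M) ^ 2 * bump ((r : ℝ) / R) ^ 2 *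
              (bump (((k * m - r : ℕ) : ℝ) / Real.sqrt 2 ^ ((ν : ℤ) - 1)) ^ 2 *
                (if r < k * m then jTerm c w B (ρ.coeff χ) (ρ.T q) k m (k * m - r) else 0)) := by
        unfold odBoxNeg
        refine Finset.sum_congr rfl fun k _ => Finset.sum_congr rfl fun m _ =>
          Finset.sum_congr rfl fun r _ => ?_
        rw [← Finset.mul_sum, ← hterm k m r]
    _ = ∑ k ∈ Icc 1 ⌊2 * K⌋₊, ∑ m ∈ Icc 1 ⌊2 * M⌋₊, ∑ ν ∈ Finset.range (J₄ + 1),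
          ∑ r ∈ Icc 1 ⌊2 * R⌋₊,
            bump ((k : ℝ) / K) ^ 2 * bump ((m : ℝ) / M) ^ 2 * bump ((r : ℝ) / R) ^ 2 *
              (bump (((k * m - r : ℕ) : ℝ) / Real.sqrt 2 ^ ((ν : ℤ) - 1)) ^ 2 *
                (if r < k * m then jTerm c w B (ρ.coeff χ) (ρ.T q) k m (k * m - r) else 0)) :=
        Finset.sum_congr rfl fun _ _ => Finset.sum_congr rfl fun _ _ => Finset.sum_comm
    _ = ∑ k ∈ Icc 1 ⌊2 * K⌋₊, ∑ ν ∈ Finset.range (J₄ + 1), ∑ m ∈ Icc 1 ⌊2 * M⌋₊,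
          ∑ r ∈ Icc 1 ⌊2 * R⌋₊,
            bump ((k : ℝ) / K) ^ 2 * bump ((m : ℝ) / M) ^ 2 * bump ((r : ℝ) / R) ^ 2 *
              (bump (((k * m - r : ℕ) : ℝ) / Real.sqrt 2 ^ ((ν : ℤ) - 1)) ^ 2 *
                (if r < k * m then jTerm c w B (ρ.coeff χ) (ρ.T q) k m (k * m - r) else 0)) :=
        Finset.sum_congr rfl fun _ _ => Finset.sum_comm
    _ = _ := Finset.sum_comm

end Literature.NumberTheory.LFunctions.BondarenkoHeap2026

end
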